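import Summits.QuantumFields.YangMills.Theorems.BalabanUVNodesN15TwoSpacingGluingCurvedKnitCovariantLandauKnit
import Summits.QuantumFields.YangMills.Theorems.BalabanUVNodesN15CurvedLocalCoefLettersOfReg335UN
import HarnessLib

/-!
# THE GLUING STEP AT TWO LATTICE SPACINGS — PROGRAMME (P-R), VIII: n15-c∕202 ON BAŁABAN's REGULARITY CLASS (3.35) — the species rows of the cube gauges PRODUCED from per-cube
# gauge data «`U^{u_k} = e^{iηA_k}` on `□̃_k`, `|A_k| < Cξ⁻¹`, `|∇^ηA_k| < Cξ⁻²`» with SITE gauges `u_k`; only the perturbation letters of `(N_V^Q + N_V^R)(U^{u_k})` remain displayed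
# (dag-n15-c g22, n15-c∕203; N15 = NE2, s1)

Cell `pub-ymgap`, seat `pub-ymgap-dag-n15-c` (R134 (a); HUMAN RULING D-0062), generation 22.  `bears_on: R4∕N15 · K3⁸ SpineGivenEndpointR13SepCoPHV (stmt-QuantumFields-27366)`.
Filed `--supports stmt-QuantumFields-27366 --as helper` — COUNT-NEUTRAL.  One plumbing `def` (`cvChiNbhd`) + one theorem; 0 `sorry`; NO new estimate (202 + dag-n15-w2's per-cube
letters).  Imports BY NAME n15-c∕202 `…CurvedKnitCovariantLandauKnit` (★★★ `cvP_cvGlued_spec`) and dag-n15-w2's `…N15CurvedLocalCoefLettersOfReg335UN` (★★★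
`uN_localCoefLetters_of_gauge335`; through it `uN_val_inv_eq_conjTranspose`, b05∕r06's `gaugeTr`, `fluct`, `covD`).  Nothing in the tree modified ∕ restated.

WHY.  n15-c∕202 is FILE 120 for the fully covariant summand with the cube gauges live; its species rows (`tCoefC`∕`tCoefA` of `Δ_{R_{U^{u_k}}}` on the cut boxes `≤ r_V`) were displayed.
[Balaban1985BackgroundPropagators] (3.35) p. 396: *«for an arbitrary cube □ of the described above class, and for a configuration U there exists a gauge transformation u on □ such
that U^u = e^{iηA}, and … |A| < O(1)Mα₀(L^jη)⁻¹, |∇^η_U A| < O(1)Mα₀(L^jη)⁻² on □»*.  THIS FILE takes exactly that datum PER CUBE OF THE COVER — a unitary SITE gauge `u₀ k`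
(component-blind, as the print's gauges are; the covariance row `hP` of 201 needs it) and a potential `A_k` with `U^{u₀ k} = e^{iηA_k}` and the two letters on the one-step
neighbourhood `cvChiNbhd k` of the cut box `supp χ_k ⊂ □̃_k` — and PRODUCES the species rows by dag-n15-w2's `uN_localCoefLetters_of_gauge335` (the extension `w` there is the
lifted gauge itself, unitary everywhere).  What stays displayed: the near ∕ far letters of `(N_V^Q + N_V^R)(U^{u₀ k})` ((3.59)–(3.60) ∕ Thms 3.2–3.3 of the print, in the model).

WHAT.  `cvChiNbhd k` (the cut box and its lattice neighbours), `mem_cvChiNbhd_self`∕`_shift`∕`_shift_symm`; ★★★ **`cvP_cvGlued_spec_class335`** — for odd `L ≥ 7`, `a > 0`, colour `ι`: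
`∃ δ w₀ R₀ θ₀ B > 0`, for every cover index, trace-form-orthonormal `e` of `M_m(ℂ)` (`m ≥ 1`), unitary site gauges `u₀ k`, a `U(m)`-VALUED bond field `U`, per-cube potentials `A_k` with
`U^{u₀ k} = e^{iηA_k}`, `‖A_k‖ < C∕ξ`, `‖η⁻¹∇^ηA_k‖ < C∕ξ²` on `cvChiNbhd k` (`η = L^{−k}`, `ξ > 0`, `C ≥ 0`), letters `r_V ≥` the two explicit (3.51)–(3.54) constants, `R_N`, `θ_F` with
`r_V(1+|J⊕J|) + R_N ≤ R₀`, `θ_F ≤ θ₀`, and the displayed near∕far rows of `N_V k := (N_V^Q + N_V^R)(U^{u₀ k})`: the glued operator of 202 is `≤ B e^{−(δ∕16)d}` blockwise AND the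
two-sided inverse of `Δ_{R_U} + a·Q*(U)Q(U) − D_U(I−R(U))D*_U`.

HONEST FRAMING ∕ LIMITS.  Assembly (202 + the per-cube letters); no new estimate; the `N_V` rows stay displayed ([B9] Thms 3.2–3.3 content + the cube-gauge transporter
smallness for `N_V^Q`; the located next objects).  MODEL as FILES 119∕181∕197∕201 (doubled-torus cover, one averaging level, uniform weights, one-level staircases, `Q(U)` = main term
(125), site gauges read at the bond's own component); the gauges are a DATUM per cube (the print's ∃ is the caller's).  NOT [Balaban1985BackgroundPropagators] Thm 3.1∕3.3 as
printed; NE2⁺ NOT PRINTED; N15 of record untouched (DISCHARGED AS CONSUMED, p687738); counts UNMOVED (typed 28∕28); one finite 𝕋⁴ at fixed ε per index — NOT infinite volume ∕ OS ∕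
mass gap ∕ Clay.  Restate-immune (no Theses import).
-/

noncomputable section

open scoped BigOperators Matrix

namespace Summit.QuantumFields.YangMills.BalabanUVNodes.N15.Gluing

open Real
open Literature.MathematicalPhysics.QuantumFieldTheory.Balaban1983to89
open Literature.MathematicalPhysics.QuantumFieldTheory.Balaban1983to89.B5Prop11Plancherel (Tor fine unitVec)
open Literature.MathematicalPhysics.QuantumFieldTheory.Balaban1983to89.B11SectG (BlockNorm HasMaj)
open Literature.MathematicalPhysics.QuantumFieldTheory.Balaban1983to89.B6Prop26Gluing (mulOp mulOp_apply)
open Literature.MathematicalPhysics.QuantumFieldTheory.Balaban1983to89.B6UnitTorusCarrier (unitTorusGeo)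
open Literature.MathematicalPhysics.QuantumFieldTheory.Balaban1983to89.B9Eq39Adjoint (covD fluct)
open Literature.MathematicalPhysics.QuantumFieldTheory.Balaban1983to89.B9Eq3117Current (gaugeTr)
open Literature.Barriers.QuantumFields (traceForm)
open Summit.QuantumFields.YangMills.BalabanUVNodes.N15.BackgroundLayer (covLapM tCoefA tCoefC)
open Summit.QuantumFields.YangMills.BalabanUVNodes.N15.VectorPiece (bshiftEquiv bshiftEquiv_apply bshiftEquiv_symm_apply)
open Summit.QuantumFields.YangMills.BalabanUVNodes.N15.MatrixSpecies (mmulOp coordMat basisConst)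
open Summit.QuantumFields.YangMills.BalabanUVNodes.N15.CurvedSpecies (gaugePair uN_localCoefLetters_of_gauge335 uN_val_inv_eq_conjTranspose)

variable {d : ℕ} (d) (L : ℕ) [NeZero L]

/-- THE ONE-STEP NEIGHBOURHOOD OF THE CUT BOX `supp χ_k`: the bond points `z` with `χ_k(z) ≠ 0`, or `χ_k(z ∓ e_μ) ≠ 0` for some `μ` — where the per-cube (3.35) datum is read.
[cite: Balaban1985BackgroundPropagators, (3.35) p.396 («on □»), (3.62)–(3.65) pp.402–403 (nested cut-offs: shape)] -/
def cvChiNbhd (mv kk : ℕ) (hL : Odd L ∧ 1 < L) (k : Fin (d + 1) → ZMod (2 * L)) : Set (CvX d L mv kk hL) :=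
  {z | cvChi d L mv kk hL k z ≠ 0 ∨ ∃ μ : Fin (d + 1), cvChi d L mv kk hL k ((bshiftEquiv (cvM d L mv kk hL) (L ^ kk) μ).symm z) ≠ 0 ∨
    cvChi d L mv kk hL k (bshiftEquiv (cvM d L mv kk hL) (L ^ kk) μ z) ≠ 0}

variable {d L}

/-- The cut box lies in its neighbourhood. [folklore] -/
theorem mem_cvChiNbhd_self {mv kk : ℕ} {hL : Odd L ∧ 1 < L} {k : Fin (d + 1) → ZMod (2 * L)} {x : CvX d L mv kk hL} (hx : cvChi d L mv kk hL k x ≠ 0) :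
    x ∈ cvChiNbhd d L mv kk hL k := Or.inl hx

/-- Forward neighbours of the cut box lie in the neighbourhood. [folklore] -/
theorem mem_cvChiNbhd_shift {mv kk : ℕ} {hL : Odd L ∧ 1 < L} {k : Fin (d + 1) → ZMod (2 * L)} {x : CvX d L mv kk hL} (hx : cvChi d L mv kk hL k x ≠ 0) (μ : Fin (d + 1)) :
    bshiftEquiv (cvM d L mv kk hL) (L ^ kk) μ x ∈ cvChiNbhd d L mv kk hL k :=
  Or.inr ⟨μ, Or.inl (by rwa [Equiv.symm_apply_apply])⟩

/-- Backward neighbours of the cut box lie in the neighbourhood. [folklore] -/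
theorem mem_cvChiNbhd_shift_symm {mv kk : ℕ} {hL : Odd L ∧ 1 < L} {k : Fin (d + 1) → ZMod (2 * L)} {x : CvX d L mv kk hL} (hx : cvChi d L mv kk hL k x ≠ 0) (μ : Fin (d + 1)) :
    (bshiftEquiv (cvM d L mv kk hL) (L ^ kk) μ).symm x ∈ cvChiNbhd d L mv kk hL k :=
  Or.inr ⟨μ, Or.inr (by rwa [Equiv.apply_symm_apply])⟩

section Knit

open scoped Matrix.Norms.L2Operator

/-- ★★★ **n15-c∕202 ON THE REGULARITY CLASS (3.35): FILE 120 FOR BAŁABAN's FULLY COVARIANT SUMMAND IN PER-CUBE SITE GAUGES, THE SPECIES ROWS PRODUCED FROM THE PER-CUBE GAUGE DATA**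
(`U^{u₀ k} = e^{iηA_k}`, `‖A_k‖ < C∕ξ`, `‖η⁻¹∇^ηA_k‖ < C∕ξ²` on the neighbourhood of the cut box; dag-n15-w2's `uN_localCoefLetters_of_gauge335` with the lifted gauge as its own unitary
extension); displayed: the near∕far letters of `(N_V^Q + N_V^R)(U^{u₀ k})`.  MODEL; NOT [B9] Thm 3.1∕3.3 as printed.
[cite: Balaban1985BackgroundPropagators, (3.35) p.396, Thm 3.1 p.397 and Thm 3.3 p.399 (shape), (3.26) p.395, (3.31)–(3.34) pp.395–396, (3.50)–(3.54) pp.400–401, (3.59)–(3.65) pp.402–403; Balaban1984PropagatorsII, (2.91)–(2.93) p.239] -/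
theorem cvP_cvGlued_spec_class335 (hL : Odd L ∧ 1 < L) (hL7 : 7 ≤ L) {a : ℝ} (ha : 0 < a) (ι : Type) [Fintype ι] [DecidableEq ι] :
    ∃ δ w₀ R₀ θ₀ B : ℝ, 0 < δ ∧ 0 < R₀ ∧ 0 < θ₀ ∧ 0 < B ∧
      ∀ (mv kk : ℕ), 1 ≤ kk → w₀ ≤ ((L ^ mv : ℕ) : ℝ) →
      ∀ {mm : Type} [Fintype mm] [DecidableEq mm] [Nonempty mm] (e : Matrix mm mm ℂ ≃L[ℝ] (ι → ℝ)), (∀ A B : Matrix mm mm ℂ, traceForm A B = e A ⬝ᵥ e B) →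
      ∀ (u₀ : (Fin (d + 1) → ZMod (2 * L)) → Tor (fine (L ^ kk) (cvM d L mv kk hL)) → (Matrix mm mm ℂ)ˣ), (∀ k x, (u₀ k x : Matrix mm mm ℂ) ∈ Matrix.unitaryGroup mm ℂ) →
      ∀ (Uu : Fin (d + 1) → CvX d L mv kk hL → (Matrix mm mm ℂ)ˣ), (∀ μ x, (Uu μ x : Matrix mm mm ℂ) ∈ Matrix.unitaryGroup mm ℂ) →
      ∀ (Acl : (Fin (d + 1) → ZMod (2 * L)) → Fin (d + 1) → CvX d L mv kk hL → Matrix mm mm ℂ) (ξ C : ℝ), 0 < ξ → 0 ≤ C →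
        (∀ k μ z, z ∈ cvChiNbhd d L mv kk hL k → gaugeTr (bshiftEquiv (cvM d L mv kk hL) (L ^ kk)) (fun z : CvX d L mv kk hL => u₀ k z.1) Uu μ z = fluct ((((L ^ kk : ℕ) : ℝ))⁻¹) (Acl k) μ z) →
        (∀ k μ z, z ∈ cvChiNbhd d L mv kk hL k → ‖Acl k μ z‖ < C * ξ⁻¹) →
        (∀ k μ ν z, z ∈ cvChiNbhd d L mv kk hL k → ‖(((((((L ^ kk : ℕ) : ℝ))⁻¹) : ℝ) : ℂ)⁻¹) • covD (bshiftEquiv (cvM d L mv kk hL) (L ^ kk)) (fun _ _ => (1 : (Matrix mm mm ℂ)ˣ)) μ (Acl k ν) z‖ < C * (ξ ^ 2)⁻¹) →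
      ∀ (rV RN θF : ℝ),
        0 ≤ rV → 0 ≤ RN → 0 ≤ θF → rV * (1 + Fintype.card (Fin (d + 1) ⊕ Fin (d + 1))) + RN ≤ R₀ → θF ≤ θ₀ →
        Fintype.card ι * (@basisConst ι _ (Matrix mm mm ℂ) Matrix.frobeniusNormedAddCommGroup Matrix.frobeniusNormedSpace e * (2 * Real.sqrt (Fintype.card mm)) * (Real.sqrt (Fintype.card mm) * ((C / ξ) * Real.exp (((((L ^ kk : ℕ) : ℝ))⁻¹) * (C / ξ))))) ≤ rV →
        Fintype.card ι * (Fintype.card (Fin (d + 1)) * (Fintype.card ι * (@basisConst ι _ (Matrix mm mm ℂ) Matrix.frobeniusNormedAddCommGroup Matrix.frobeniusNormedSpace e * (2 * Real.sqrt (Fintype.card mm)) * (Real.sqrt (Fintype.card mm) * ((C / ξ) * Real.exp (((((L ^ kk : ℕ) : ℝ))⁻¹) * (C / ξ))))) ^ 2 + @basisConst ι _ (Matrix mm mm ℂ) Matrix.frobeniusNormedAddCommGroup Matrix.frobeniusNormedSpace e * (2 * Real.sqrt (Fintype.card mm)) * (Real.sqrt (Fintype.card mm) * ((C / ξ ^ 2)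 * Real.exp (((((L ^ kk : ℕ) : ℝ))⁻¹) * (C / ξ)))))) ≤ rV →
        (∀ k, HasMaj (CvNorm d L mv kk hL ι) (CvNorm d L mv kk hL ι) (mulOp (fun p : CvX d L mv kk hL × ι => cvPsi d L mv kk hL k p.1) ∘ₗ (cvNVq d L mv kk hL a ι e (cvGauge d L mv kk hL (fun p => (u₀ k p.1 : Matrix mm mm ℂ)) (fun μ x => (Uu μ x : Matrix mm mm ℂ))) + cvNVr d L mv kk hL a ι e (cvGauge d L mv kk hL (fun p => (u₀ k p.1 : Matrix mm mm ℂ)) (fun μ x => (Uu μ x : Matrix mm mm ℂ)))) ∘ₗ mulOp (fun p : CvX d L mv kk hL × ι => cvChi d L mv kk hL k p.1)) (fun y y' => RN * Real.exp (-(δ * (unitTorusGeo L kk (cvM d L mv kk hL)).dist y y')))) →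
        (∀ k, HasMaj (CvNorm d L mv kk hL ι) (CvNorm d L mv kk hL ι) ((LinearMap.id - mulOp (fun p : CvX d L mv kk hL × ι => cvPsi d L mv kk hL k p.1)) ∘ₗ (cvNVq d L mv kk hL a ι e (cvGauge d L mv kk hL (fun p => (u₀ k p.1 : Matrix mm mm ℂ)) (fun μ x => (Uu μ x : Matrix mm mm ℂ))) + cvNVr d L mv kk hL a ι e (cvGauge d L mv kk hL (fun p => (u₀ k p.1 : Matrix mm mm ℂ)) (fun μ x => (Uu μ x : Matrix mm mm ℂ)))) ∘ₗ mulOp (fun p : CvX d L mv kk hL × ι => cvChi d L mv kk hL k p.1)) (fun y y' => θF * Real.exp (-(δ * (unitTorusGeo L kk (cvM d L mv kk hL)).dist y y')))) →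
        HasMaj (CvNorm d L mv kk hL ι) (CvNorm d L mv kk hL ι) (cvGlued d L mv kk hL a ((((L ^ kk : ℕ) : ℝ))⁻¹) ι e (fun k (p : CvX d L mv kk hL) => (u₀ k p.1 : Matrix mm mm ℂ)) (fun μ x => (Uu μ x : Matrix mm mm ℂ)) (cvNL d L mv kk hL a ι - cvNVq d L mv kk hL a ι e (fun μ x => (Uu μ x : Matrix mm mm ℂ)) - cvNVr d L mv kk hL a ι e (fun μ x => (Uu μ x : Matrix mm mm ℂ))) (fun k => (cvNVq d L mv kk hL a ι e (cvGauge d L mv kk hL (fun p => (u₀ k p.1 : Matrix mm mm ℂ)) (fun μ x => (Uu μ x : Matrix mm mm ℂ))) + cvNVr d L mv kk hL a ι e (cvGauge d L mv kk hL (fun p => (u₀ k p.1 : Matrix mm mm ℂ)) (fun μ x => (Uu μ x : Matrix mm mm ℂ))))))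
          (fun y y' => B * Real.exp (-(δ / 16 * (unitTorusGeo L kk (cvM d L mv kk hL)).dist y y'))) ∧
        (cvGlued d L mv kk hL a ((((L ^ kk : ℕ) : ℝ))⁻¹) ι e (fun k (p : CvX d L mv kk hL) => (u₀ k p.1 : Matrix mm mm ℂ)) (fun μ x => (Uu μ x : Matrix mm mm ℂ)) (cvNL d L mv kk hL a ι - cvNVq d L mv kk hL a ι e (fun μ x => (Uu μ x : Matrix mm mm ℂ)) - cvNVr d L mv kk hL a ι e (fun μ x => (Uu μ x : Matrix mm mm ℂ))) (fun k => (cvNVq d L mv kk hL a ι e (cvGauge d L mv kk hL (fun p => (u₀ k p.1 : Matrix mm mm ℂ)) (fun μ x => (Uu μ x : Matrix mm mm ℂ))) + cvNVr d L mv kk hL a ι e (cvGauge d L mv kk hL (fun p => (u₀ k p.1 : Matrix mm mm ℂ)) (fun μ x => (Uu μ x : Matrix mm mm ℂ))))) ∘ₗ (covLapM (bshiftEquiv (cvM d L mv kk hL) (L ^ kk)) ((((L ^ kk : ℕ) : ℝ))⁻¹) (gaugePair (bshiftEquiv (cvM d L mv kk hL) (L ^ kk)) (fun μ x => coordMat e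 (ContinuousLinearMap.mulLeftRight ℝ (Matrix mm mm ℂ) ((Uu μ x : Matrix mm mm ℂ)) ((Uu μ x : Matrix mm mm ℂ))ᴴ))) + (cvNL d L mv kk hL a ι - cvNVq d L mv kk hL a ι e (fun μ x => (Uu μ x : Matrix mm mm ℂ)) - cvNVr d L mv kk hL a ι e (fun μ x => (Uu μ x : Matrix mm mm ℂ)))) = LinearMap.id ∧
          (covLapM (bshiftEquiv (cvM d L mv kk hL) (L ^ kk)) ((((L ^ kk : ℕ) : ℝ))⁻¹) (gaugePair (bshiftEquiv (cvM d L mv kk hL) (L ^ kk)) (fun μ x => coordMat e (ContinuousLinearMap.mulLeftRight ℝ (Matrix mm mm ℂ) ((Uu μ x : Matrix mm mm ℂ)) ((Uu μ x : Matrix mm mm ℂ))ᴴ))) + (cvNL d L mv kk hL a ι - cvNVq d L mv kk hL a ι e (fun μ x => (Uu μ x : Matrix mm mm ℂ)) - cvNVr d L mv kk hL a ι e (fun μ x => (Uu μ x : Matrix mm mm ℂ)))) ∘ₗ cvGlued d L mv kk hL a ((((L ^ kk : ℕ) : ℝ))⁻¹) ι e (fun k (p : CvX d L mv kk hL) =>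 (u₀ k p.1 : Matrix mm mm ℂ)) (fun μ x => (Uu μ x : Matrix mm mm ℂ)) (cvNL d L mv kk hL a ι - cvNVq d L mv kk hL a ι e (fun μ x => (Uu μ x : Matrix mm mm ℂ)) - cvNVr d L mv kk hL a ι e (fun μ x => (Uu μ x : Matrix mm mm ℂ))) (fun k => (cvNVq d L mv kk hL a ι e (cvGauge d L mv kk hL (fun p => (u₀ k p.1 : Matrix mm mm ℂ)) (fun μ x => (Uu μ x : Matrix mm mm ℂ))) + cvNVr d L mv kk hL a ι e (cvGauge d L mv kk hL (fun p => (u₀ k p.1 : Matrix mm mm ℂ)) (fun μ x => (Uu μ x : Matrix mm mm ℂ))))) = LinearMap.id)  := by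
  obtain ⟨δ, w₀, R₀, θ₀, B, hδ, hR₀, hθ₀, hB, H⟩ := cvP_cvGlued_spec (d := d) hL hL7 ha ι
  refine ⟨δ, w₀, R₀, θ₀, B, hδ, hR₀, hθ₀, hB, fun mv kk hk hw₀ => ?_⟩
  intro mm _ _ _ e he u₀ hu₀ Uu hUu Acl ξ C hξ hC hg hAcl hDcl rV RN θF hrV hRN hθF hRle hθle hrA hrC hNVcut hfarN
  have hη : (0 : ℝ) < ((((L ^ kk : ℕ) : ℝ))⁻¹) := inv_pos.mpr (Nat.cast_pos.mpr (pow_pos (Nat.pos_of_ne_zero (NeZero.ne L)) kk))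
  -- the lifted site gauges are unitary everywhere, hence of unitary type (operator norm) and orthogonal in coordinates
  have hw : ∀ k (y : CvX d L mv kk hL), ((u₀ k y.1 : Matrix mm mm ℂ))ᴴ * (u₀ k y.1 : Matrix mm mm ℂ) = 1 := fun k y => Matrix.mem_unitaryGroup_iff'.mp (hu₀ k y.1)
  have hu1 : ∀ k (z : CvX d L mv kk hL), ‖((u₀ k z.1 : (Matrix mm mm ℂ)ˣ) : Matrix mm mm ℂ)‖ ≤ 1 ∧ ‖((((u₀ k z.1)⁻¹ : (Matrix mm mm ℂ)ˣ)) : Matrix mm mm ℂ)‖ ≤ 1 := fun k z =>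
    ⟨(CStarRing.norm_of_mem_unitary (hu₀ k z.1)).le, by
      rw [uN_val_inv_eq_conjTranspose (hu₀ k z.1)]
      exact (CStarRing.norm_of_mem_unitary (Unitary.star_mem (hu₀ k z.1))).le⟩
  have hlet : ∀ k (x : CvX d L mv kk hL), cvChi d L mv kk hL k x ≠ 0 → _ := fun k x hx =>
    uN_localCoefLetters_of_gauge335 e (bshiftEquiv (cvM d L mv kk hL) (L ^ kk)) Uu he hη hUu (Q := cvChiNbhd d L mv kk hL k) hξ hC
      (u := fun z : CvX d L mv kk hL => u₀ k z.1) (A := Acl k) (fun z _ => hu1 k z) (hg k) (hAcl k) (hDcl k)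
      (w := fun z : CvX d L mv kk hL => (u₀ k z.1 : Matrix mm mm ℂ)) (hw k) (fun z _ => rfl) (mem_cvChiNbhd_self hx) (mem_cvChiNbhd_shift hx) (mem_cvChiNbhd_shift_symm hx)
  exact H mv kk hk hw₀ e he (fun k x => (u₀ k x : Matrix mm mm ℂ)) (fun k x => Matrix.mem_unitaryGroup_iff'.mp (hu₀ k x)) (fun μ x => (Uu μ x : Matrix mm mm ℂ)) rV RN θF
    hrV hRN hθF hRle hθle (fun k x hx i => ((hlet k x hx).2 i).trans hrC) (fun k j' x hx i => ((hlet k x hx).1 j' i).trans hrA) hNVcut hfarN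

end Knit

end Summit.QuantumFields.YangMills.BalabanUVNodes.N15.Gluing

end
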